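import Summits.KontsevichZagierPeriods.KontsevichZagierPeriods.Theorems.PentagonInKZ.Negative.RulesAssociator
import Literature.NumberTheory.Transcendental.KZCubicalCalculus
import Literature.NumberTheory.Transcendental.KZProductIdeal
import Literature.NumberTheory.Transcendental.KZLogCalculusProofs
import Literature.NumberTheory.Transcendental.SemialgebraicLineDeriv
import Literature.NumberTheory.Transcendental.AssociatorsBaseChange
import Literature.NumberTheory.Transcendental.AssociatorsHexagonProofs

/-!
# `PentagonInKZ`, line `edge-normal-newton-leibniz`: corner assembly — aux 1 (classes of cube integrands; transfer)

First toolkit file for the assembly step (B) of the corner principle (`cornerPrinciple_of_uniformlyNull`,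
stub `cornerPrinciple_assembly` of crux `PentagonInKZ`, stmt-KontsevichZagierPeriods-11348):
* transfer: an element of `K ⊗_ℚ V` killed by `id ⊗ μ` for every functional `μ` of `V` vanishes
  (`eq_zero_of_forall_lTensor`); its avatar for `DK_N(R) ↪ R ⊗_ℚ DK_N(ℚ)` (`dk_eq_zero_of_forall`,
  registered hook `cornerAssembly_transfer`), products of truncated evaluations and `dk_sum4_eq`;
* bookkeeping: `sum_range_sum_range_eq` (square of bidegrees by total degree), `wZ_mul_wZ_eq_zero`;
* the classes `χ₀ [[0,1]^d, f] ∈ P_ℚ = ℚ ⊗ (FormalRep ⧸ relations)` of good (`ℚ`-semialgebraic,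
  absolutely integrable) cube integrands — no definition is introduced, statements spell the terms
  out — and their calculus from the Kontsevich–Zagier moves (congruence, additivity, finite sums,
  rational scalars, Fubini product of two blocks `cls_block`, one defect term `cls_term`).
-/

noncomputable section

open Set MeasureTheory
open scoped TensorProduct
open Literature.NumberTheory.Transcendental
open Literature.ModelTheory.ExponentialFields (IsSemialgebraic)
open Summit.KontsevichZagierPeriods.FurushoPentagon.PentagonInKZNegative

namespace Summit.KontsevichZagierPeriods.FurushoPentagon.PentagonInKZ

namespace CornerAssembly

/-! ### Transfer: testing zero in `K ⊗_ℚ V` with functionals -/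

/-- An element of `K ⊗_ℚ V` (`V` a `ℚ`-vector space) on which `id ⊗ μ` vanishes for every linear
functional `μ` of `V` is zero (coordinates in a basis of `V`). [folklore] -/
theorem eq_zero_of_forall_lTensor {K V : Type*} [AddCommGroup K] [Module ℚ K] [AddCommGroup V]
    [Module ℚ V] (x : K ⊗[ℚ] V) (h : ∀ μ : V →ₗ[ℚ] ℚ, μ.lTensor K x = 0) : x = 0 := by
  classical
  let b := Module.Basis.ofVectorSpace ℚ V
  let e : K ⊗[ℚ] V ≃ₗ[ℚ] (Module.Basis.ofVectorSpaceIndex ℚ V →₀ K) :=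
    (TensorProduct.congr (LinearEquiv.refl ℚ K) b.repr).trans
      (TensorProduct.finsuppScalarRight ℚ ℚ K (Module.Basis.ofVectorSpaceIndex ℚ V))
  rw [← e.map_eq_zero_iff]
  ext i
  let μ : V →ₗ[ℚ] ℚ := Finsupp.lapply i ∘ₗ b.repr.toLinearMap
  have key : Finsupp.lapply i ∘ₗ e.toLinearMap =
      (TensorProduct.rid ℚ K).toLinearMap ∘ₗ μ.lTensor K := by
    refine TensorProduct.ext' fun c v => ?_
    simp [e, μ, TensorProduct.finsuppScalarRight_apply_tmul_apply]
  have := LinearMap.congr_fun key x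
  simp only [LinearMap.coe_comp, Function.comp_apply, Finsupp.lapply_apply,
    LinearEquiv.coe_coe] at this
  rw [Finsupp.zero_apply, this, h μ, map_zero]

/-- `c ⊗ q = (q • c) ⊗ 1` in `K ⊗_ℚ ℚ`. [folklore] -/
theorem tmul_rat_eq {K : Type*} [AddCommGroup K] [Module ℚ K] (c : K) (q : ℚ) :
    c ⊗ₜ[ℚ] q = (q • c) ⊗ₜ[ℚ] (1 : ℚ) := by
  rw [TensorProduct.smul_tmul, smul_eq_mul, mul_one]

/-- The comparison map `toModel : DK_N(R) → R ⊗_ℚ DK_N(ℚ)` sends the base change of `x` to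
`1 ⊗ x`. [folklore] -/
theorem toModel_map_algebraMap {R : Type} [CommRing R] [Algebra ℚ R] {ι : Type} (N : ℕ)
    (x : DrinfeldKohnoTrunc ℚ ι N) :
    DrinfeldKohnoTrunc.toModel R ι N (DrinfeldKohnoTrunc.map (algebraMap ℚ R) x) =
      (1 : R) ⊗ₜ[ℚ] x := by
  induction x using DrinfeldKohnoTrunc.induction_on' ℚ ι N with
  | halg q =>
    rw [DrinfeldKohnoTrunc.map_algebraMap, AlgHom.commutes,
      Algebra.TensorProduct.algebraMap_apply, Algebra.algebraMap_self_apply,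
      Algebra.algebraMap_eq_smul_one, Algebra.algebraMap_eq_smul_one, TensorProduct.smul_tmul]
  | ht i j => rw [DrinfeldKohnoTrunc.map_t, DrinfeldKohnoTrunc.toModel_t]
  | hadd x y hx hy => rw [map_add, map_add, hx, hy, TensorProduct.tmul_add]
  | hmul x y hx hy =>
    rw [map_mul, map_mul, hx, hy, Algebra.TensorProduct.tmul_mul_tmul, mul_one]

/-- **Transfer to `DK_N(R)`**: an element of the truncated Drinfeld–Kohno algebra over a
`ℚ`-algebra `R` vanishes as soon as `id ⊗ μ` kills its image in the base-change model
`R ⊗_ℚ DK_N(ℚ)` for every `ℚ`-linear functional `μ` (`toModel` is injective). [folklore] -/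
theorem dk_eq_zero_of_forall {R : Type} [CommRing R] [Algebra ℚ R] {ι : Type} {N : ℕ}
    (X : DrinfeldKohnoTrunc R ι N)
    (h : ∀ μ : DrinfeldKohnoTrunc ℚ ι N →ₗ[ℚ] ℚ,
      μ.lTensor R (DrinfeldKohnoTrunc.toModel R ι N X) = 0) : X = 0 := by
  apply DrinfeldKohnoTrunc.toModel_injective R ι N
  rw [map_zero]
  exact eq_zero_of_forall_lTensor _ h

/-! ### Regrouping a square of bidegrees by total degree -/

/-- `Σ_{k,l ≤ N} T(k,l) = Σ_{n ≤ N} Σ_{k ≤ n} T(k, n-k)` when `T` vanishes above total degree `N`.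
[folklore] -/
theorem sum_range_sum_range_eq {M : Type*} [AddCommMonoid M] (N : ℕ) (T : ℕ → ℕ → M)
    (hT : ∀ k l, N < k + l → T k l = 0) :
    ∑ k ∈ Finset.range (N + 1), ∑ l ∈ Finset.range (N + 1), T k l =
      ∑ n ∈ Finset.range (N + 1), ∑ k ∈ Finset.range (n + 1), T k (n - k) := by
  have h1 : ∀ k ∈ Finset.range (N + 1), ∑ l ∈ Finset.range (N + 1), T k l =
      ∑ l ∈ (Finset.range (N + 1)).filter (fun l => k + l ≤ N), T k l := by
    intro k _
    rw [Finset.sum_filter]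
    refine Finset.sum_congr rfl fun l _ => ?_
    split_ifs with h
    · rfl
    · exact hT k l (by omega)
  rw [Finset.sum_congr rfl h1, Finset.sum_sigma', Finset.sum_sigma']
  refine Finset.sum_nbij' (fun p => ⟨p.1 + p.2, p.1⟩) (fun p => ⟨p.2, p.1 - p.2⟩) ?_ ?_ ?_ ?_ ?_
  · rintro ⟨k, l⟩ hp
    simp only [Finset.mem_sigma, Finset.mem_range, Finset.mem_filter] at hp ⊢
    omega
  · rintro ⟨n, k⟩ hp
    simp only [Finset.mem_sigma, Finset.mem_range, Finset.mem_filter] at hp ⊢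
    omega
  · rintro ⟨k, l⟩ hp
    simp only [Finset.mem_sigma, Finset.mem_range, Finset.mem_filter] at hp
    ext
    · rfl
    · simp
  · rintro ⟨n, k⟩ hp
    simp only [Finset.mem_sigma, Finset.mem_range] at hp
    ext
    · simp only; omega
    · rfl
  · rintro ⟨k, l⟩ _
    simp

/-! ### Classes of cube integrands in `P_ℚ` -/

/-- The realisations of two formal combinations differing by a relation agree at the universal
realisation `χ₀ : FormalRep → P_ℚ`. [folklore] -/
theorem chiUniv_eq_of_sub_mem {a b : KZ.FormalRep} (h : a - b ∈ KZ.relations) :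
    chiUniv a = chiUniv b := by
  have := isRealisation_chiUniv.rel _ h
  rwa [map_sub, sub_eq_zero] at this

/-! A *good* cube integrand `f` on `[0,1]^d` is a `ℚ`-semialgebraic, absolutely integrable
function on the closed unit cube (`IsSemialgebraicFunOn ℚ (KZ.cube d) f ∧ IntegrableOn f (KZ.cube d)`,
the data of a Kontsevich–Zagier representation `KZ.IntegralRep.mk (KZ.cube d) f …` over the cube);
its class is `χ₀ [[0,1]^d, f] ∈ P_ℚ`. No definition is introduced: statements spell these terms out. -/

variable {d : ℕ} {f g : (Fin d → ℝ) → ℝ}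

/-- Goodness only depends on the values on the cube. [folklore] -/
theorem good_congr (hf : (IsSemialgebraicFunOn ℚ (KZ.cube d) f ∧ IntegrableOn f (KZ.cube d))) (h : EqOn f g (KZ.cube d)) : (IsSemialgebraicFunOn ℚ (KZ.cube d) g ∧ IntegrableOn g (KZ.cube d)) :=
  ⟨hf.1.congr h, hf.2.congr_fun h KZ.measurableSet_cube⟩

/-- **Congruence**: a representation over the cube whose integrand agrees with a good `g` on the
cube has the class of `g` (rule (1b) with a zero representation).
[cite: KontsevichZagier2001, §1.2 rule (1)] -/
theorem cls_eq_of_eqOn (r : KZ.IntegralRep d) (hr : r.domain = KZ.cube d) (hg : (IsSemialgebraicFunOn ℚ (KZ.cube d) g ∧ IntegrableOn g (KZ.cube d)))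
    (h : EqOn r.integrand g (KZ.cube d)) : chiUniv (KZ.of r) = chiUniv (KZ.of (KZ.IntegralRep.mk (KZ.cube d) g KZ.isSemialgebraic_cube (And.left hg) (And.right hg))) :=
  chiUniv_eq_of_sub_mem (KZ.of_sub_of_mem_relations_of_eqOn hr.symm fun _ hx => h (hr ▸ hx))

/-- Integrands agreeing on the cube have the same class. [cite: KontsevichZagier2001, §1.2 rule (1)] -/
theorem cls_congr (hf : (IsSemialgebraicFunOn ℚ (KZ.cube d) f ∧ IntegrableOn f (KZ.cube d))) (hg : (IsSemialgebraicFunOn ℚ (KZ.cube d) g ∧ IntegrableOn g (KZ.cube d))) (h : EqOn f g (KZ.cube d)) :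
    chiUniv (KZ.of (KZ.IntegralRep.mk (KZ.cube d) f KZ.isSemialgebraic_cube (And.left hf) (And.right hf))) = chiUniv (KZ.of (KZ.IntegralRep.mk (KZ.cube d) g KZ.isSemialgebraic_cube (And.left hg) (And.right hg))) :=
  cls_eq_of_eqOn _ rfl hg h

/-- Rational constants are good. [folklore] -/
theorem good_const (d : ℕ) (q : ℚ) : (IsSemialgebraicFunOn ℚ (KZ.cube d) (fun _ => (q : ℝ)) ∧ IntegrableOn (fun _ => (q : ℝ)) (KZ.cube d)) :=
  ⟨isSemialgebraicFunOn_const_ratCast KZ.isSemialgebraic_cube q,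
    integrableOn_const (by simp)⟩

/-- The zero integrand is good. [folklore] -/
theorem good_zero (d : ℕ) : (IsSemialgebraicFunOn ℚ (KZ.cube d) (fun _ => (0 : ℝ)) ∧ IntegrableOn (fun _ => (0 : ℝ)) (KZ.cube d)) := by
  simpa using good_const d 0

/-- **An integrand vanishing on the cube has class `0`.** [cite: KontsevichZagier2001, §1.2 rule (1)] -/
theorem cls_eq_zero_of_eqOn (hf : (IsSemialgebraicFunOn ℚ (KZ.cube d) f ∧ IntegrableOn f (KZ.cube d))) (h : EqOn f 0 (KZ.cube d)) : chiUniv (KZ.of (KZ.IntegralRep.mk (KZ.cube d) f KZ.isSemialgebraic_cube (And.left hf) (And.right hf))) = 0 :=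
  isRealisation_chiUniv.rel _ (KZ.of_mem_relations_of_eqOn_zero _ h)

/-- Sums of good integrands are good. [folklore] -/
theorem good_add (hf : (IsSemialgebraicFunOn ℚ (KZ.cube d) f ∧ IntegrableOn f (KZ.cube d))) (hg : (IsSemialgebraicFunOn ℚ (KZ.cube d) g ∧ IntegrableOn g (KZ.cube d))) : (IsSemialgebraicFunOn ℚ (KZ.cube d) (fun x => f x + g x) ∧ IntegrableOn (fun x => f x + g x) (KZ.cube d)) :=
  ⟨hf.1.fun_add hg.1, hf.2.add hg.2⟩

/-- **Additivity** `⟦f + g⟧ = ⟦f⟧ + ⟦g⟧` (rule (1b)). [cite: KontsevichZagier2001, §1.2 rule (1)] -/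
theorem cls_add (hf : (IsSemialgebraicFunOn ℚ (KZ.cube d) f ∧ IntegrableOn f (KZ.cube d))) (hg : (IsSemialgebraicFunOn ℚ (KZ.cube d) g ∧ IntegrableOn g (KZ.cube d))) :
    chiUniv (KZ.of (KZ.IntegralRep.mk (KZ.cube d) (fun x => f x + g x) KZ.isSemialgebraic_cube (And.left (good_add hf hg)) (And.right (good_add hf hg)))) = chiUniv (KZ.of (KZ.IntegralRep.mk (KZ.cube d) f KZ.isSemialgebraic_cube (And.left hf) (And.right hf))) + chiUniv (KZ.of (KZ.IntegralRep.mk (KZ.cube d) g KZ.isSemialgebraic_cube (And.left hg) (And.right hg))) := by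
  rw [← map_add]
  apply chiUniv_eq_of_sub_mem
  rw [← sub_sub]
  exact KZ.integrandAddRel_subset_relations
    ⟨d, (KZ.IntegralRep.mk (KZ.cube d) (fun x => f x + g x) KZ.isSemialgebraic_cube (And.left (good_add hf hg)) (And.right (good_add hf hg))), (KZ.IntegralRep.mk (KZ.cube d) f KZ.isSemialgebraic_cube (And.left hf) (And.right hf)), (KZ.IntegralRep.mk (KZ.cube d) g KZ.isSemialgebraic_cube (And.left hg) (And.right hg)), rfl, rfl,
      fun x _ => rfl, rfl⟩

/-- Finite sums of good integrands are good. [folklore] -/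
theorem good_sum {ι : Type*} (s : Finset ι) {F : ι → (Fin d → ℝ) → ℝ}
    (hF : ∀ i ∈ s, (IsSemialgebraicFunOn ℚ (KZ.cube d) (F i) ∧ IntegrableOn (F i) (KZ.cube d))) : (IsSemialgebraicFunOn ℚ (KZ.cube d) (fun x => ∑ i ∈ s, F i x) ∧ IntegrableOn (fun x => ∑ i ∈ s, F i x) (KZ.cube d)) :=
  ⟨IsSemialgebraicFunOn.fun_finsetSum s KZ.isSemialgebraic_cube fun i hi => (hF i hi).1,
    integrable_finsetSum s fun i hi => (hF i hi).2⟩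

/-- **Finite additivity** `⟦Σᵢ fᵢ⟧ = Σᵢ ⟦fᵢ⟧`. [cite: KontsevichZagier2001, §1.2 rule (1)] -/
theorem cls_sum {ι : Type*} (s : Finset ι) {F : ι → (Fin d → ℝ) → ℝ} (hF : ∀ i, (IsSemialgebraicFunOn ℚ (KZ.cube d) (F i) ∧ IntegrableOn (F i) (KZ.cube d))) :
    chiUniv (KZ.of (KZ.IntegralRep.mk (KZ.cube d) (fun x => ∑ i ∈ s, F i x) KZ.isSemialgebraic_cube (And.left (good_sum s fun i _ => hF i)) (And.right (good_sum s fun i _ => hF i)))) = ∑ i ∈ s, chiUniv (KZ.of (KZ.IntegralRep.mk (KZ.cube d) (F i) KZ.isSemialgebraic_cube (And.left (hF i)) (And.right (hF i)))) := by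
  classical
  induction s using Finset.induction_on with
  | empty =>
    rw [Finset.sum_empty]
    exact cls_eq_zero_of_eqOn (good_sum _ fun i _ => hF i) fun x _ => Finset.sum_empty
  | insert a s ha ih =>
    rw [Finset.sum_insert ha, ← ih, ← cls_add (hF a) (good_sum s fun i _ => hF i)]
    exact cls_congr (good_sum _ fun i _ => hF i) (good_add (hF a) (good_sum s fun i _ => hF i))
      fun x _ => Finset.sum_insert ha

/-- Differences of good integrands are good. [folklore] -/
theorem good_sub (hf : (IsSemialgebraicFunOn ℚ (KZ.cube d) f ∧ IntegrableOn f (KZ.cube d))) (hg : (IsSemialgebraicFunOn ℚ (KZ.cube d) g ∧ IntegrableOn g (KZ.cube d))) : (IsSemialgebraicFunOn ℚ (KZ.cube d) (fun x => f x - g x) ∧ IntegrableOn (fun x => f x - g x) (KZ.cube d)) :=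
  ⟨hf.1.fun_sub hg.1, hf.2.sub hg.2⟩

/-- `⟦f - g⟧ = ⟦f⟧ - ⟦g⟧`. [cite: KontsevichZagier2001, §1.2 rule (1)] -/
theorem cls_sub (hf : (IsSemialgebraicFunOn ℚ (KZ.cube d) f ∧ IntegrableOn f (KZ.cube d))) (hg : (IsSemialgebraicFunOn ℚ (KZ.cube d) g ∧ IntegrableOn g (KZ.cube d))) :
    chiUniv (KZ.of (KZ.IntegralRep.mk (KZ.cube d) (fun x => f x - g x) KZ.isSemialgebraic_cube (And.left (good_sub hf hg)) (And.right (good_sub hf hg)))) = chiUniv (KZ.of (KZ.IntegralRep.mk (KZ.cube d) f KZ.isSemialgebraic_cube (And.left hf) (And.right hf))) - chiUniv (KZ.of (KZ.IntegralRep.mk (KZ.cube d) g KZ.isSemialgebraic_cube (And.left hg) (And.right hg))) := by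
  rw [eq_sub_iff_add_eq, ← cls_add (good_sub hf hg) hg]
  exact cls_congr (good_add (good_sub hf hg) hg) hf fun x _ => sub_add_cancel (f x) (g x)

/-- Rational multiples of good integrands are good. [folklore] -/
theorem good_const_mul (hf : (IsSemialgebraicFunOn ℚ (KZ.cube d) f ∧ IntegrableOn f (KZ.cube d))) (q : ℚ) : (IsSemialgebraicFunOn ℚ (KZ.cube d) (fun x => (q : ℝ) * f x) ∧ IntegrableOn (fun x => (q : ℝ) * f x) (KZ.cube d)) :=
  ⟨(isSemialgebraicFunOn_const_ratCast KZ.isSemialgebraic_cube q).fun_mul hf.1, hf.2.const_mul _⟩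

/-- **Rational scalars** `⟦q · f⟧ = q • ⟦f⟧` in `P_ℚ` (additivity makes `q ↦ ⟦q · f⟧` additive, hence
`ℚ`-linear). [cite: KontsevichZagier2001, §1.2 rule (1)] -/
theorem cls_const_mul (hf : (IsSemialgebraicFunOn ℚ (KZ.cube d) f ∧ IntegrableOn f (KZ.cube d))) (q : ℚ) :
    chiUniv (KZ.of (KZ.IntegralRep.mk (KZ.cube d) (fun x => (q : ℝ) * f x) KZ.isSemialgebraic_cube (And.left (good_const_mul hf q)) (And.right (good_const_mul hf q)))) = q • chiUniv (KZ.of (KZ.IntegralRep.mk (KZ.cube d) f KZ.isSemialgebraic_cube (And.left hf) (And.right hf))) := by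
  let φ : ℚ →+ KZ.FormalPeriodAlgebra :=
    { toFun := fun q => chiUniv (KZ.of (KZ.IntegralRep.mk (KZ.cube d) (fun x => (q : ℝ) * f x) KZ.isSemialgebraic_cube (And.left (good_const_mul hf q)) (And.right (good_const_mul hf q))))
      map_zero' := cls_eq_zero_of_eqOn (good_const_mul hf 0) fun x _ => by simp
      map_add' := fun a b => by
        rw [← cls_add (good_const_mul hf a) (good_const_mul hf b)]
        exact cls_congr (good_const_mul hf (a + b))
          (good_add (good_const_mul hf a) (good_const_mul hf b))
          fun x _ => by simp only [Rat.cast_add, add_mul] }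
  have h1 : φ q = q • φ 1 := by
    rw [← map_rat_smul φ q 1, smul_eq_mul, mul_one]
  have h2 : φ 1 = chiUniv (KZ.of (KZ.IntegralRep.mk (KZ.cube d) f KZ.isSemialgebraic_cube (And.left hf) (And.right hf))) := cls_congr (good_const_mul hf 1) hf fun x _ => by
    simp only [Rat.cast_one, one_mul]
  rw [← h2, ← h1]
  rfl

/-- **Fubini product of two blocks**: for good `f` on `[0,1]^a` and `g` on `[0,1]^b`, the
integrand `z ↦ f(z|_a) g(z|^b)` on `[0,1]^{a+b}` (first `a` coordinates, last `b` coordinates) is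
good and its class is `⟦f⟧ ⟦g⟧`. [cite: KontsevichZagier2001, §4.1] -/
theorem cls_block {a b : ℕ} {f : (Fin a → ℝ) → ℝ} {g : (Fin b → ℝ) → ℝ} (hf : (IsSemialgebraicFunOn ℚ (KZ.cube a) f ∧ IntegrableOn f (KZ.cube a)))
    (hg : (IsSemialgebraicFunOn ℚ (KZ.cube b) g ∧ IntegrableOn g (KZ.cube b))) :
    (IsSemialgebraicFunOn ℚ (KZ.cube (a + b)) (fun z => f (fun i => z (Fin.castAdd b i)) * g (fun j => z (Fin.natAdd a j))) ∧ IntegrableOn (fun z => f (fun i => z (Fin.castAdd b i)) * g (fun j => z (Fin.natAdd a j))) (KZ.cube (a + b))) ∧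
    ∀ h : (IsSemialgebraicFunOn ℚ (KZ.cube (a + b)) (fun z => f (fun i => z (Fin.castAdd b i)) * g (fun j => z (Fin.natAdd a j))) ∧ IntegrableOn (fun z => f (fun i => z (Fin.castAdd b i)) * g (fun j => z (Fin.natAdd a j))) (KZ.cube (a + b))),
      chiUniv (KZ.of (KZ.IntegralRep.mk (KZ.cube (a + b)) (fun z => f (fun i => z (Fin.castAdd b i)) * g (fun j => z (Fin.natAdd a j))) KZ.isSemialgebraic_cube (And.left h) (And.right h))) =
        chiUniv (KZ.of (KZ.IntegralRep.mk (KZ.cube a) f KZ.isSemialgebraic_cube (And.left hf) (And.right hf))) * chiUniv (KZ.of (KZ.IntegralRep.mk (KZ.cube b) g KZ.isSemialgebraic_cube (And.left hg) (And.right hg))) := by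
  let r := (KZ.IntegralRep.mk (KZ.cube a) f KZ.isSemialgebraic_cube (And.left hf) (And.right hf))
  let s := (KZ.IntegralRep.mk (KZ.cube b) g KZ.isSemialgebraic_cube (And.left hg) (And.right hg))
  have hdom : KZ.IntegralRep.prodDomain r s = KZ.cube (a + b) := by
    ext z
    simp only [KZ.IntegralRep.prodDomain, mem_setOf_eq, KZ.mem_cube, r, s]
    constructor
    · rintro ⟨h1, h2⟩ i
      induction i using Fin.addCases with
      | left i => exact h1 i
      | right j => exact h2 j
    · intro h
      exact ⟨fun i => h _, fun j => h _⟩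
  have hint : (r.prod s).integrand =
      fun z => f (fun i => z (Fin.castAdd b i)) * g (fun j => z (Fin.natAdd a j)) :=
    KZ.IntegralRep.prod_integrand_eq r s
  have hgood : (IsSemialgebraicFunOn ℚ (KZ.cube (a + b)) (fun z => f (fun i => z (Fin.castAdd b i)) * g (fun j => z (Fin.natAdd a j))) ∧ IntegrableOn (fun z => f (fun i => z (Fin.castAdd b i)) * g (fun j => z (Fin.natAdd a j))) (KZ.cube (a + b))) := by
    constructor
    · have := (r.prod s).isSemialgebraicFunOn_integrand
      rwa [hint, KZ.IntegralRep.prod_domain, hdom] at this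
    · have := (r.prod s).integrableOn
      rwa [hint, KZ.IntegralRep.prod_domain, hdom] at this
  refine ⟨hgood, fun h => ?_⟩
  rw [← isRealisation_chiUniv.mul, KZ.of_mul_of]
  apply chiUniv_eq_of_sub_mem
  exact KZ.of_sub_of_mem_relations_of_eqOn (by rw [KZ.IntegralRep.prod_domain, hdom])
    (fun z _ => by rw [hint])

/-- A representation of dimension `0` whose integrand is `1` on its (total) domain is the unit
modulo relations. [cite: KontsevichZagier2001, §4.1] -/
theorem of_sub_of_unit_mem {r : KZ.IntegralRep 0} (hd : ∀ t, t ∈ r.domain)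
    (hi : ∀ t ∈ r.domain, r.integrand t = 1) :
    KZ.of r - KZ.of KZ.IntegralRep.unit ∈ KZ.relations :=
  KZ.of_sub_of_mem_relations_of_eqOn
    (by rw [KZ.IntegralRep.unit_domain]; exact (eq_univ_of_forall hd).symm)
    (fun t ht => by rw [hi t ht]; rfl)

/-! ### One term of the corner defect -/

/-- **One term of the defect**: for good horizontal integrands `fH1, fH0` and vertical `gV0, gVa`
and rational coefficients `a, b`, the integrand `a · fH1(x) gV0(y) − b · gVa(y) fH0(x)` on
`[0,1]^{k+l}` is good with class `a • ⟦fH1⟧⟦gV0⟧ − b • ⟦fH0⟧⟦gVa⟧`. [cite: KontsevichZagier2001, §4.1] -/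
theorem cls_term {k l : ℕ} (a b : ℚ) {fH1 fH0 : (Fin k → ℝ) → ℝ} {gV0 gVa : (Fin l → ℝ) → ℝ}
    (hH1 : (IsSemialgebraicFunOn ℚ (KZ.cube k) fH1 ∧ IntegrableOn fH1 (KZ.cube k))) (hH0 : (IsSemialgebraicFunOn ℚ (KZ.cube k) fH0 ∧ IntegrableOn fH0 (KZ.cube k))) (hV0 : (IsSemialgebraicFunOn ℚ (KZ.cube l) gV0 ∧ IntegrableOn gV0 (KZ.cube l))) (hVa : (IsSemialgebraicFunOn ℚ (KZ.cube l) gVa ∧ IntegrableOn gVa (KZ.cube l))) :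
    (IsSemialgebraicFunOn ℚ (KZ.cube (k + l)) (fun z => (a : ℝ) * (fH1 (fun i => z (Fin.castAdd l i)) * gV0 (fun j => z (Fin.natAdd k j))) - (b : ℝ) * (gVa (fun j => z (Fin.natAdd k j)) * fH0 (fun i => z (Fin.castAdd l i)))) ∧ IntegrableOn (fun z => (a : ℝ) * (fH1 (fun i => z (Fin.castAdd l i)) * gV0 (fun j => z (Fin.natAdd k j))) - (b : ℝ) * (gVa (fun j => z (Fin.natAdd k j)) * fH0 (fun i => z (Fin.castAdd l i)))) (KZ.cube (k + l))) ∧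
    ∀ h : (IsSemialgebraicFunOn ℚ (KZ.cube (k + l)) (fun z => (a : ℝ) * (fH1 (fun i => z (Fin.castAdd l i)) * gV0 (fun j => z (Fin.natAdd k j))) - (b : ℝ) * (gVa (fun j => z (Fin.natAdd k j)) * fH0 (fun i => z (Fin.castAdd l i)))) ∧ IntegrableOn (fun z => (a : ℝ) * (fH1 (fun i => z (Fin.castAdd l i)) * gV0 (fun j => z (Fin.natAdd k j))) - (b : ℝ) * (gVa (fun j => z (Fin.natAdd k j)) * fH0 (fun i => z (Fin.castAdd l i)))) (KZ.cube (k + l))),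
    chiUniv (KZ.of (KZ.IntegralRep.mk (KZ.cube (k + l)) (fun z => (a : ℝ) * (fH1 (fun i => z (Fin.castAdd l i)) * gV0 (fun j => z (Fin.natAdd k j))) - (b : ℝ) * (gVa (fun j => z (Fin.natAdd k j)) * fH0 (fun i => z (Fin.castAdd l i)))) KZ.isSemialgebraic_cube (And.left h) (And.right h))) =
      a • (chiUniv (KZ.of (KZ.IntegralRep.mk (KZ.cube k) fH1 KZ.isSemialgebraic_cube (And.left hH1) (And.right hH1))) * chiUniv (KZ.of (KZ.IntegralRep.mk (KZ.cube l) gV0 KZ.isSemialgebraic_cube (And.left hV0) (And.right hV0)))) - b • (chiUniv (KZ.of (KZ.IntegralRep.mk (KZ.cube k) fH0 KZ.isSemialgebraic_cube (And.left hH0) (And.right hH0))) * chiUniv (KZ.of (KZ.IntegralRep.mk (KZ.cube l) gVa KZ.isSemialgebraic_cube (And.left hVa) (And.right hVa)))) := by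
  obtain ⟨hb1, hc1⟩ := cls_block hH1 hV0
  obtain ⟨hb2, hc2⟩ := cls_block hH0 hVa
  have hb2' : (IsSemialgebraicFunOn ℚ (KZ.cube (k + l)) (fun z => gVa (fun j => z (Fin.natAdd k j)) * fH0 (fun i => z (Fin.castAdd l i))) ∧ IntegrableOn (fun z => gVa (fun j => z (Fin.natAdd k j)) * fH0 (fun i => z (Fin.castAdd l i))) (KZ.cube (k + l))) :=
    good_congr hb2 fun z _ => mul_comm _ _
  have hc2' : chiUniv (KZ.of (KZ.IntegralRep.mk (KZ.cube (k + l)) (fun z => gVa (fun j => z (Fin.natAdd k j)) * fH0 (fun i => z (Fin.castAdd l i))) KZ.isSemialgebraic_cube (And.left hb2') (And.right hb2'))) =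
      chiUniv (KZ.of (KZ.IntegralRep.mk (KZ.cube k) fH0 KZ.isSemialgebraic_cube (And.left hH0) (And.right hH0))) * chiUniv (KZ.of (KZ.IntegralRep.mk (KZ.cube l) gVa KZ.isSemialgebraic_cube (And.left hVa) (And.right hVa))) := by
    rw [← hc2 hb2]
    exact cls_congr hb2' hb2 fun z _ => mul_comm _ _
  refine ⟨good_sub (good_const_mul hb1 a) (good_const_mul hb2' b), fun h => ?_⟩
  rw [cls_sub (good_const_mul hb1 a) (good_const_mul hb2' b), cls_const_mul hb1, cls_const_mul hb2',
    hc1 hb1, hc2']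

/-! ### Truncation of residue monomials -/

/-- **Truncation**: residue monomials `Z_U = Z_{U₀} ⋯ Z_{U_{k-1}}`, `Z_V` of total length `> N`
multiply to `0` in `DK_N(ℚ)` (every `Z_k` is a combination of generators). [cite: Furusho2011, §2] -/
theorem wZ_mul_wZ_eq_zero {m N : ℕ} (nZ : Fin (m + 2) → Fin 4 → Fin 4 → ℤ)
    (wZ : ∀ {n : ℕ}, (Fin n → Fin (m + 2)) → DrinfeldKohnoTrunc ℚ (Fin 4) N)
    (hwZ : ∀ {n : ℕ} (U : Fin n → Fin (m + 2)), wZ U =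
      ((List.ofFn U).map fun k => ∑ i : Fin 4, ∑ j : Fin 4,
        (nZ k i j : ℚ) • DrinfeldKohnoTrunc.t ℚ N i j).prod)
    {k l : ℕ} (hkl : N < k + l) (U : Fin k → Fin (m + 2)) (V : Fin l → Fin (m + 2)) :
    wZ U * wZ V = 0 := by
  rw [hwZ, hwZ, ← List.prod_append, ← List.map_append]
  apply DrinfeldKohnoTrunc.prod_map_eq_zero_of_mem_genSpan
  · intro b
    exact Submodule.sum_mem _ fun i _ => Submodule.sum_mem _ fun j _ =>
      Submodule.smul_mem _ _ (DrinfeldKohnoTrunc.t_mem_genSpan i j)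
  · simp only [List.length_append, List.length_ofFn]
    exact hkl

/-! ### Products of truncated evaluations and the transfer `DK_N(R) ↪ R ⊗ DK_N(ℚ)` -/

section Transfer

variable {L : Type} [Fintype L] {R : Type} [CommRing R] [Algebra ℚ R] {N : ℕ}

/-- **Product of two truncated evaluations** at residues that are base changes of rational
residue monomials `wq`: `P(Z) Q(Z) = Σ_{k,l ≤ N} Σ_{U,V} P(U) Q(V) • (wq U · wq V)_R`.
[cite: Furusho2011, §2] -/
theorem evalTrunc_mul_evalTrunc (Z : L → DrinfeldKohnoTrunc R (Fin 4) N)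
    (wq : ∀ {n : ℕ}, (Fin n → L) → DrinfeldKohnoTrunc ℚ (Fin 4) N)
    (hZ : ∀ {n : ℕ} (f : Fin n → L),
      ((List.ofFn f).map Z).prod = DrinfeldKohnoTrunc.map (algebraMap ℚ R) (wq f))
    (P Q : NCSeries L R) :
    NCSeries.evalTrunc N Z P * NCSeries.evalTrunc N Z Q =
      ∑ k ∈ Finset.range (N + 1), ∑ l ∈ Finset.range (N + 1), ∑ U : Fin k → L, ∑ V : Fin l → L,
        (P (List.ofFn U) * Q (List.ofFn V)) •
          DrinfeldKohnoTrunc.map (algebraMap ℚ R) (wq U * wq V) := by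
  unfold NCSeries.evalTrunc
  simp_rw [hZ]
  rw [Finset.sum_mul_sum]
  refine Finset.sum_congr rfl fun k _ => Finset.sum_congr rfl fun l _ => ?_
  rw [Finset.sum_mul_sum]
  refine Finset.sum_congr rfl fun U _ => Finset.sum_congr rfl fun V _ => ?_
  rw [smul_mul_smul_comm, map_mul]

/-- **Transfer of a bidegree-indexed identity to `DK_N(R)`**: two sums `Σ a • x_R` and `Σ b • y_R`
of base-changed rational monomials with coefficients in `R` agree as soon as, for every
`ℚ`-linear functional `μ` of `DK_N(ℚ)`, `Σ (μ(x) a − μ(y) b) = 0` in `R` (injectivity of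
`toModel` and the functional test in `R ⊗_ℚ DK_N(ℚ)`). [folklore] -/
theorem dk_sum4_eq (M : ℕ) (a b : ∀ k l : ℕ, (Fin k → L) → (Fin l → L) → R)
    (x y : ∀ k l : ℕ, (Fin k → L) → (Fin l → L) → DrinfeldKohnoTrunc ℚ (Fin 4) N)
    (h : ∀ μ : DrinfeldKohnoTrunc ℚ (Fin 4) N →ₗ[ℚ] ℚ,
      ∑ k ∈ Finset.range M, ∑ l ∈ Finset.range M, ∑ U : Fin k → L, ∑ V : Fin l → L,
        (μ (x k l U V) • a k l U V - μ (y k l U V) • b k l U V) = 0) :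
    ∑ k ∈ Finset.range M, ∑ l ∈ Finset.range M, ∑ U : Fin k → L, ∑ V : Fin l → L,
        a k l U V • DrinfeldKohnoTrunc.map (algebraMap ℚ R) (x k l U V) =
      ∑ k ∈ Finset.range M, ∑ l ∈ Finset.range M, ∑ U : Fin k → L, ∑ V : Fin l → L,
        b k l U V • DrinfeldKohnoTrunc.map (algebraMap ℚ R) (y k l U V) := by
  rw [← sub_eq_zero]
  apply dk_eq_zero_of_forall
  intro μ
  have hμ := h μ
  simp only [Finset.sum_sub_distrib] at hμ
  simp only [map_sub, map_sum, map_smul, toModel_map_algebraMap, TensorProduct.smul_tmul',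
    smul_eq_mul, mul_one, LinearMap.lTensor_tmul]
  simp_rw [tmul_rat_eq _ (μ _), ← TensorProduct.sum_tmul, ← TensorProduct.sub_tmul]
  rw [hμ, TensorProduct.zero_tmul]

end Transfer

end CornerAssembly

open CornerAssembly in
/-- **Hook `cornerAssembly_transfer`** (registered spelling): an element of the truncated
Drinfeld–Kohno algebra over a `ℚ`-algebra `R` vanishes as soon as `id ⊗ μ` kills its image in
`R ⊗_ℚ DK_N(ℚ)` for every `ℚ`-linear functional `μ`. [folklore] -/
theorem cornerAssembly_transfer : ∀ (R : Type) [CommRing R] [Algebra ℚ R] (ι : Type) (N : ℕ) (X : DrinfeldKohnoTrunc R ι N), (∀ μ : DrinfeldKohnoTrunc ℚ ι N →ₗ[ℚ] ℚ, μ.lTensor R (DrinfeldKohnoTrunc.toModel R ι N X) = 0) → X = 0 :=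
  fun _ _ _ _ _ X h => dk_eq_zero_of_forall X h

end Summit.KontsevichZagierPeriods.FurushoPentagon.PentagonInKZ
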